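import Mathlib
import Literature.Topology.FourManifolds.PlanarAchiralWords
import HarnessLib

/-!
# Orbit invariants of the signed planar word calculus: sign counts and hole ranges along `Reachable`

Topic `Literature/Topology/FourManifolds`, companion of `PlanarAchiralWords.lean` (the signed planar
word calculus `Literature.Topology.FourManifolds.PlanarWords`: planar curves, achiral words, the
five moves `Move` — rotation, the signed Hurwitz move and its inverse, global conjugation, planar
stabilisation — and the equivalence relation `Reachable` they generate).  General combinatorics of
lists; nothing topological is asserted or assumed.  Written for the proof line `Sketch` of the crux
`ConvexBisection.PlanarAcyclicBisectionRigidity` (item stmt-SmoothPoincare4-15086), as the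
word-level input of clause (iv) of its registered stub `stub_wendlDictionary` (skeleton v2.0): "a
reachable block word both of whose blocks are simply connected re-bisects the 4-manifold into
CONTRACTIBLE Stein halves".  On paper the re-read block `X_{A'}` of a state on `n'` holes is a
2-handlebody on `♮^{n'}(S¹ × B³)` with `|A'|` two-handles, `χ(X_{A'}) = 1 - n' + |A'|`, so a simply
connected block is contractible exactly when `|A'| = n'` (`b₁ = 0` forces `b₂ = χ - 1 + b₁ = 0`;
Hurewicz–Whitehead), and the re-read blocks are Stein only if every vanishing cycle encloses a
NONEMPTY block of holes of the CURRENT page.  Both are syntactic invariants of the orbit, for every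
number of holes:

* `reachable_signDefect`, `length_of_reachable_blockForm`, `length_of_reachable`: along the orbit
  the number of positive (resp. negative) letters minus the number of holes is constant
  (stabilisation adds one hole, one positive and one negative letter; the other moves permute the
  signs); so every block form reachable from an integral homotopy-sphere word `(n; A, B)` has
  `|A'| = |B'| = n'` letters a side on its `n'` holes.
* `reachable_holes_iff`, `holes_of_reachable`: every letter `⟨a, b, g⟩` of every state reachable
  from an integral homotopy-sphere word, on `n'` holes, satisfies `a ≤ b < n'` — its round block
  `x_a ⋯ x_b` is a nonempty in-range block, a non-trivial element of `F_{n'}` (`blockWord_ne_one`,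
  `blockWord_ne_one_of_reachable`) — although its carrying word `g` may leave the in-range
  sub-alphabet (global conjugation `Move.conj` is unrestricted; destabilisation is only offered at
  in-range states, so no out-of-range generator is ever re-read at another level).

## What is NOT here (design)

No semantic statement (arc data, classes `PlanarCurve.cls`, `NormallyGenerates`, `TwistEq`): the
invariance of the total monodromy, of the joint normal closure of the classes, and the behaviour of
the block groups `F_{n'} ⧸ ⟪cls A'⟫` under the moves need the `ArcData` monoid/automorphism laws
and are left to the files that use them.
-/

noncomputable section

namespace Literature.Topology.FourManifolds.PlanarWords

/-! ## Signs: `n'` positive and `n'` negative letters on `n'` holes -/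

/-- A Hurwitz image keeps the sign of the letter it moves. [folklore] -/
@[simp] theorem hurwitzAct_snd (x y : Letter) : (hurwitzAct x y).2 = y.2 := rfl

/-- Global conjugation keeps every sign. [folklore] -/
@[simp] theorem signs_map_image (g : List PGen) (w : List Letter) :
    (w.map fun l => (PlanarCurve.image g l.1, l.2)).map Prod.snd = w.map Prod.snd := by
  simp [List.map_map, Function.comp_def]

/-- The signs of a block form `A · B̄ʳᵉᵛ`: `|A|` positive letters, then `|B|` negative ones. [folklore] -/
@[simp] theorem signs_blockForm (A B : List PlanarCurve) :
    (blockForm A B).map Prod.snd = List.replicate A.length true ++ List.replicate B.length false := by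
  simp [blockForm, positiveWord, List.map_reverse, Function.comp_def]

/-- Each move preserves the SIGN DEFECT "number of letters of sign `b` minus number of holes"
(rotation, Hurwitz moves and conjugation permute the signs on the same number of holes;
stabilisation adds one hole, one positive and one negative letter). [folklore] -/
theorem move_signDefect {s t : ℕ × List Letter} (h : Move s t) (b : Bool) :
    ((s.2.map Prod.snd).count b : ℤ) - s.1 = ((t.2.map Prod.snd).count b : ℤ) - t.1 := by
  cases h with
  | rotate n l w =>
      have hp : ((w ++ [l]).map Prod.snd).Perm ((l :: w).map Prod.snd) := by
        simp [List.perm_append_singleton]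
      simp only [hp.count_eq]
  | hurwitz n pre post x y =>
      have hp : ((pre ++ hurwitzAct x y :: x :: post).map Prod.snd).Perm
          ((pre ++ x :: y :: post).map Prod.snd) := by
        simpa using (List.Perm.swap x.2 y.2 (post.map Prod.snd)).append_left (pre.map Prod.snd)
      simp only [hp.count_eq]
  | hurwitzInv n pre post x y =>
      have hp : ((pre ++ y :: hurwitzAct (y.1, !y.2) x :: post).map Prod.snd).Perm
          ((pre ++ x :: y :: post).map Prod.snd) := by
        simpa using (List.Perm.swap x.2 y.2 (post.map Prod.snd)).append_left (pre.map Prod.snd)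
      simp only [hp.count_eq]
  | conj n g w => simp only [signs_map_image]
  | stabilize n m g w hm hg hw =>
      have hc : ((((⟨m, n, g⟩, true) : Letter) :: ((⟨m, n, g⟩, false) : Letter) :: w).map Prod.snd).count b =
          (w.map Prod.snd).count b + 1 := by
        cases b <;> simp
      simp only [hc]
      push_cast
      ring

/-- The sign defect is an invariant of the orbit `Reachable` (moves and their inverses). [folklore] -/
theorem reachable_signDefect {s t : ℕ × List Letter} (h : Reachable s t) (b : Bool) :
    ((s.2.map Prod.snd).count b : ℤ) - s.1 = ((t.2.map Prod.snd).count b : ℤ) - t.1 := by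
  unfold Reachable at h
  induction h with
  | refl => rfl
  | tail _ hst ih =>
      exact ih.trans (hst.elim (fun h' => move_signDefect h' b) fun h' => (move_signDefect h' b).symm)

/-- **Length invariance.**  Every block form reachable from a block form with `n` letters a side
on `n` holes has `n'` letters a side on its `n'` holes (so the re-read blocks keep
`χ = 1 - n' + n' = 1`). [folklore] -/
theorem length_of_reachable_blockForm {n n' : ℕ} {A B A' B' : List PlanarCurve}
    (h : Reachable (n, blockForm A B) (n', blockForm A' B')) (hA : A.length = n)
    (hB : B.length = n) : A'.length = n' ∧ B'.length = n' := by
  have k₁ := reachable_signDefect h true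
  have k₂ := reachable_signDefect h false
  simp only [signs_blockForm, List.count_append, List.count_replicate] at k₁ k₂
  simp at k₁ k₂
  omega

/-- **Length invariance for integral homotopy-sphere words** (the form clause (iv) of
`stub_wendlDictionary` v2.0 consumes: `|A'| = |B'| = n'` at every reachable block form). [folklore] -/
theorem length_of_reachable {n n' : ℕ} {A B A' B' : List PlanarCurve}
    (hw : IsIntegralSphereWord n A B) (h : Reachable (n, blockForm A B) (n', blockForm A' B')) :
    A'.length = n' ∧ B'.length = n' :=
  length_of_reachable_blockForm h hw.length_left hw.length_right

/-! ## Holes: every letter encloses a nonempty in-range block of the current page -/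

/-- A Hurwitz image keeps the first hole of the round block of the letter it moves. [folklore] -/
@[simp] theorem hurwitzAct_fst_a (x y : Letter) : (hurwitzAct x y).1.a = y.1.a := rfl

/-- A Hurwitz image keeps the last hole of the round block of the letter it moves. [folklore] -/
@[simp] theorem hurwitzAct_fst_b (x y : Letter) : (hurwitzAct x y).1.b = y.1.b := rfl

/-- An image curve keeps the first hole of its round block. [folklore] -/
@[simp] theorem image_a (g : List PGen) (c : PlanarCurve) : (c.image g).a = c.a := rfl

/-- An image curve keeps the last hole of its round block. [folklore] -/
@[simp] theorem image_b (g : List PGen) (c : PlanarCurve) : (c.image g).b = c.b := rfl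

/-- Each move preserves "every letter `⟨a, b, g⟩` has `a ≤ b < n`", in both directions (Hurwitz
images and conjugates keep the round block `[a, b]`; a stabilising pair `⟨m, n, g⟩`, `m ≤ n`, is in
range on `n + 1` holes, and destabilisation is only offered when the remaining letters are in range
on `n` holes). [folklore] -/
theorem move_holes_iff {s t : ℕ × List Letter} (h : Move s t) :
    (∀ l ∈ s.2, l.1.a ≤ l.1.b ∧ l.1.b < s.1) ↔ (∀ l ∈ t.2, l.1.a ≤ l.1.b ∧ l.1.b < t.1) := by
  cases h with
  | rotate n l w =>
      constructor
      · intro H l' hl'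
        exact H l' (by simp only [List.mem_append, List.mem_cons, List.not_mem_nil, or_false] at hl' ⊢; tauto)
      · intro H l' hl'
        exact H l' (by simp only [List.mem_append, List.mem_cons, List.not_mem_nil, or_false] at hl' ⊢; tauto)
  | hurwitz n pre post x y =>
      simp only [List.forall_mem_append, List.forall_mem_cons, hurwitzAct_fst_a, hurwitzAct_fst_b]
      tauto
  | hurwitzInv n pre post x y =>
      simp only [List.forall_mem_append, List.forall_mem_cons, hurwitzAct_fst_a, hurwitzAct_fst_b]
      tauto
  | conj n g w =>
      simp only [List.forall_mem_map, image_a, image_b]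
  | stabilize n m g w hm hg hw =>
      constructor
      · intro _ l hl
        simp only [List.mem_cons] at hl
        rcases hl with rfl | rfl | hl
        · exact ⟨hm, Nat.lt_succ_self n⟩
        · exact ⟨hm, Nat.lt_succ_self n⟩
        · obtain ⟨h1, h2, -⟩ := hw l hl
          exact ⟨h1, Nat.lt_succ_of_lt h2⟩
      · intro _ l hl
        obtain ⟨h1, h2, -⟩ := hw l hl
        exact ⟨h1, h2⟩

/-- "Every letter has `a ≤ b < n`" is an invariant of the orbit `Reachable`. [folklore] -/
theorem reachable_holes_iff {s t : ℕ × List Letter} (h : Reachable s t) :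
    (∀ l ∈ s.2, l.1.a ≤ l.1.b ∧ l.1.b < s.1) ↔ (∀ l ∈ t.2, l.1.a ≤ l.1.b ∧ l.1.b < t.1) := by
  unfold Reachable at h
  induction h with
  | refl => exact Iff.rfl
  | tail _ hst ih => exact ih.trans (hst.elim move_holes_iff fun h' => (move_holes_iff h').symm)

/-- The letters of an integral homotopy-sphere word have `a ≤ b < n` (they are in range). [folklore] -/
theorem holes_of_isIntegralSphereWord {n : ℕ} {A B : List PlanarCurve}
    (hw : IsIntegralSphereWord n A B) : ∀ l ∈ blockForm A B, l.1.a ≤ l.1.b ∧ l.1.b < n := by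
  intro l hl
  simp only [blockForm, positiveWord, List.mem_append, List.mem_map, List.mem_reverse] at hl
  rcases hl with ⟨c, hc, rfl⟩ | ⟨c, hc, rfl⟩
  · obtain ⟨h1, h2, -⟩ := hw.inRange c (List.mem_append_left _ hc)
    exact ⟨h1, h2⟩
  · obtain ⟨h1, h2, -⟩ := hw.inRange c (List.mem_append_right _ hc)
    exact ⟨h1, h2⟩

/-- **Hole-range invariance.**  Every letter of every state reachable from an integral
homotopy-sphere word encloses a nonempty in-range block of holes of its current page:
`a ≤ b < n'`. [folklore] -/
theorem holes_of_reachable {n n' : ℕ} {A B : List PlanarCurve} {w' : List Letter}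
    (hw : IsIntegralSphereWord n A B) (h : Reachable (n, blockForm A B) (n', w')) :
    ∀ l ∈ w', l.1.a ≤ l.1.b ∧ l.1.b < n' :=
  (reachable_holes_iff h).1 (holes_of_isIntegralSphereWord hw)

/-- A nonempty in-range round block `x_a ⋯ x_b` (`a ≤ b < n`) is a non-trivial element of `F_n`:
its exponent sum is the number of holes `a, …, b`, which is positive. [folklore] -/
theorem blockWord_ne_one {n a b : ℕ} (hab : a ≤ b) (hb : b < n) : PGen.blockWord n a b ≠ 1 := by
  classical
  set L := (List.finRange n).filter fun i => decide (a ≤ i.val ∧ i.val ≤ b) with hL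
  have hmem : (⟨b, hb⟩ : Fin n) ∈ L := by simp [hL, hab]
  have hlen : L.length ≠ 0 := fun h0 => by
    rw [List.length_eq_zero_iff] at h0
    simp [h0] at hmem
  let ε : FreeGroup (Fin n) →* Multiplicative ℤ := FreeGroup.lift fun _ => Multiplicative.ofAdd 1
  have hε : ε (PGen.blockWord n a b) = Multiplicative.ofAdd (L.length : ℤ) := by
    have h1 : PGen.blockWord n a b = (L.map FreeGroup.of).prod := rfl
    have hconst : (⇑ε ∘ FreeGroup.of : Fin n → Multiplicative ℤ) = fun _ => Multiplicative.ofAdd 1 := by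
      funext i; simp [ε]
    rw [h1, map_list_prod, List.map_map, hconst, List.map_const', List.prod_replicate, ← ofAdd_nsmul,
      nsmul_one]
  intro h
  rw [h, map_one] at hε
  have hz : (L.length : ℤ) = 0 := by
    have := congrArg Multiplicative.toAdd hε
    simpa using this.symm
  exact hlen (by exact_mod_cast hz)

/-- In particular the round block of every letter of every reachable state is non-trivial in the
free group of its current page (no vanishing cycle of a re-read block is a round null-homotopic
curve). [folklore] -/
theorem blockWord_ne_one_of_reachable {n n' : ℕ} {A B : List PlanarCurve} {w' : List Letter}
    (hw : IsIntegralSphereWord n A B) (h : Reachable (n, blockForm A B) (n', w')) :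
    ∀ l ∈ w', PGen.blockWord n' l.1.a l.1.b ≠ 1 := fun l hl =>
  blockWord_ne_one (holes_of_reachable hw h l hl).1 (holes_of_reachable hw h l hl).2

end Literature.Topology.FourManifolds.PlanarWords

end
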